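import Literature.MathematicalPhysics.QuantumLattice.FermionBlockProductStateEntropy
import Literature.MathematicalPhysics.QuantumLattice.FermionFreeBoundaryPressureExists
import Literature.MathematicalPhysics.QuantumLattice.PeriodicStatesCellAverage
import HarnessLib

/-!
# The periodic product of ONE even box state over the box tiling `n·v + [0,n)^d` of `ℤ^d`, and its
# translation-invariant cell average (the trial states of the Gibbs variational principle)

Topic `Literature/MathematicalPhysics/QuantumLattice` (family `hubbard`, model-free, general `d`). Instance of
`FermionBlockProductState.lean` (Araki–Moriya product `⊗_i ρ_i` of even block density matrices over a partition of `ℤ^d`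
into finite blocks): the blocks are the boxes `B_v = n·v + [0,n)^d` (`v ∈ ℤ^d`, `n ≥ 1`) and every block carries the SAME
even density matrix `ρ₀ ∈ 𝔄([0,n)^d)`, transported to `B_v` along the translation `x ↦ x − n·v`. This is the state
`⊗_{v ∈ ℤ^d} ρ₀` of Bratteli–Robinson II Prop. 6.2.38 / Thm. 6.2.40 (proof of the variational principle): it is
`nℤ^d`-PERIODIC, its marginal on every box is (the transport of) `ρ₀`, and its cell average over `[0,n)^d` is a
TRANSLATION-INVARIANT state — the trial state whose entropy and energy densities (`FermionBoxTilingTrialState.lean`) are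
`S(ρ₀)/n^d` and `tr(ρ₀ H_{[0,n)^d})/n^d` up to a surface term.

* §1 `boxPartition d n hn : BlockPartition d ℤ^d` (`cls x = ⌊x/n⌋` coordinatewise, `block v = n·v + [0,n)^d`).
* §2 `boxBackEquiv n v : B_v ≃ [0,n)^d` (`x ↦ x − n·v`, ordered sites) and the transported box states
  `boxCopy n ρ₀ v = tr_{boxBackEquiv} ρ₀ ∈ 𝔄(B_v)`: positive / faithful / even / trace / entropy as `ρ₀`;
  `tr(Γ_{τ_{n v}} A · boxCopy v) = tr(A ρ₀)`.
* §3 **`InfVolFermionState.boxTilingState n hn ρ₀ hev hpsd htr`** (`= blockProductState (boxPartition …) (boxCopy n ρ₀) …`):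
  `ω_{B_v}(Γ_{τ_{nv}} A) = tr(A ρ₀)`, `ω(H_{B_v}) = tr(H_{[0,n)^d} ρ₀)` for translation-covariant `Ψ`, `ρ_{B_v}(ω) = boxCopy v`.
* §4 **PERIODICITY** `ω ∘ τ_{n·w} = ω` (`boxTilingState_shift_smul`, by uniqueness of block product states) ⇒
  `IsPeriodic (fun _ => n − 1) ω`; **`boxTrialState … := cellAverage`** is TRANSLATION INVARIANT
  (`boxTrialState_isTranslationInvariant`).

Everything is PROVED; definitions with bodies: `boxPartition`, `boxBackEquiv`, `boxCopy`, `InfVolFermionState.boxTilingState`,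
`InfVolFermionState.boxTrialState`; no named fact, no number.

## Tree / Mathlib search

REUSED: `BlockPartition`, `blockProductState`, `blockProductState_expect_block/_expect_prod`, `rdm_blockProductState_block`,
`eq_blockProductState_of_forall_prod`, `blockVal` (`FermionBlockProductState`); `posDef_fermionPartialTrace` (`…Entropy`);
`mem_shiftSet_smul_halfOpenBox` (`TIStateMeanEntropy`); `fermionPartialTrace` API (`FermionPartialTrace`);
`IsTranslationInvariant.fermionEmbed_shiftEmb_localHamiltonian` (`FermionLocalHamiltonianCovariance`); `shiftAverage`, `cellAverage`,
`IsPeriodic`, `periodVec`, `isTranslationInvariant_cellAverage` (`PeriodicStatesCellAverage`); `shift_expect`, `PolySite.shiftEmb/incl/pt`;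
Mathlib `Int.le_ediv_iff_mul_le`, `Int.ediv_lt_iff_lt_mul`, `Int.add_mul_ediv_left`. `lean search 'boxTiling|periodic product state'`
(2026-08-28): nothing.

## References

* O. Bratteli, D. W. Robinson, *OAQSM 2* (1997), Prop. 6.2.38 and Thm. 6.2.40 (the periodic product state `⊗ ρ_Λ` over a
  box tiling and its lattice average in the proof of `P = sup(s − βe)`). [cite: BratteliRobinsonII1997, Thm. 6.2.40]
* H. Araki, H. Moriya, Rev. Math. Phys. 15 (2003) 93, §11.1 Thm. 11.2 (product states of even states), §4.1 Def. 4.3/4.5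
  (translations, periodic and invariant states). [cite: ArakiMoriya2003, §11.1 Theorem 11.2]
* R. B. Israel, *Convexity in the Theory of Lattice Gases* (1979), §II.2 (the same construction for classical/quantum
  lattice systems). [cite: Israel1979, Thm. I.2.4]
-/

noncomputable section

namespace Literature.MathematicalPhysics.QuantumLattice

open Matrix Finset HubbardWave0 Literature.Probability.LatticeModels ThermodynamicLimit
open scoped ComplexOrder BigOperators
open Literature.InformationTheory.Entropy (vonNeumannEntropy)

variable {d : ℕ}

/-! ### §1. The box partition of `ℤ^d` -/

/-- **The box partition** of `ℤ^d` into the boxes `B_v = n·v + [0,n)^d`, `v ∈ ℤ^d` (`n ≥ 1`): the class of `x` is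
`v = ⌊x/n⌋` (coordinatewise Euclidean quotient). Reducible, so that `block v` unfolds to `n·v + [0,n)^d` silently.
[cite: BratteliRobinsonII1997, Thm. 6.2.40] -/
@[reducible] def boxPartition (d n : ℕ) (hn : 1 ≤ n) : BlockPartition d (Site d) where
  cls x := fun i => x i / (n : ℤ)
  block v := shiftSet ((n : ℤ) • v) (halfOpenBox d n)
  mem_block_iff v x := by
    have hn' : (0 : ℤ) < n := by exact_mod_cast hn
    rw [InfVolFermionState.mem_shiftSet_smul_halfOpenBox]
    constructor
    · intro h
      funext i
      obtain ⟨h1, h2⟩ := h i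
      refine le_antisymm ?_ ((Int.le_ediv_iff_mul_le hn').2 (by linarith))
      have h3 : x i / (n : ℤ) < v i + 1 := (Int.ediv_lt_iff_lt_mul hn').2 (by linarith)
      omega
    · intro h i
      have hi : x i / (n : ℤ) = v i := congrFun h i
      constructor
      · have := (Int.le_ediv_iff_mul_le hn').1 hi.ge
        linarith
      · have := (Int.ediv_lt_iff_lt_mul hn').1 (show x i / (n : ℤ) < v i + 1 by omega)
        linarith

/-- The class map of the box partition (definitional). [cite: BratteliRobinsonII1997, Thm. 6.2.40] -/
theorem boxPartition_cls (n : ℕ) (hn : 1 ≤ n) (x : Site d) : (boxPartition d n hn).cls x = fun i => x i / (n : ℤ) := rfl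

/-- The blocks of the box partition (definitional). [cite: BratteliRobinsonII1997, Thm. 6.2.40] -/
theorem boxPartition_block (n : ℕ) (hn : 1 ≤ n) (v : Site d) :
    (boxPartition d n hn).block v = shiftSet ((n : ℤ) • v) (halfOpenBox d n) := rfl

/-- **Translating by a superlattice vector shifts the class**: `cls(x + n·w) = cls x + w`. [cite: BratteliRobinsonII1997, Thm. 6.2.40] -/
theorem boxPartition_cls_add_smul (n : ℕ) (hn : 1 ≤ n) (x w : Site d) :
    (boxPartition d n hn).cls (x + (n : ℤ) • w) = (boxPartition d n hn).cls x + w := by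
  have hn' : (n : ℤ) ≠ 0 := by exact_mod_cast (by omega : n ≠ 0)
  funext i
  simp only [Pi.add_apply, Pi.smul_apply, smul_eq_mul]
  exact Int.add_mul_ediv_left (x i) (w i) hn'

/-- The reference box `[0,n)^d` is the block of class `0`. [cite: BratteliRobinsonII1997, Thm. 6.2.40] -/
theorem boxPartition_block_zero (n : ℕ) (hn : 1 ≤ n) : (boxPartition d n hn).block 0 = halfOpenBox d n := by
  rw [boxPartition_block, smul_zero]
  ext y
  rw [mem_shiftSet, sub_zero]

/-! ### §2. Transporting one box state to every box -/

/-- **The translation of the box `B_v = n·v + [0,n)^d` back onto the reference box** `[0,n)^d`, `x ↦ x − n·v`, as a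
bijection of ordered site sets. [cite: ArakiMoriya2003, §4.1 Def. 4.3] -/
def boxBackEquiv (n : ℕ) (v : Site d) : PolySite (shiftSet ((n : ℤ) • v) (halfOpenBox d n)) ≃ PolySite (halfOpenBox d n) where
  toFun y := PolySite.pt (ofLex y.1 - (n : ℤ) • v) (mem_shiftSet.1 (PolySite.ofLex_mem y))
  invFun z := PolySite.pt (ofLex z.1 + (n : ℤ) • v) (PolySite.add_mem_shiftSet _ (PolySite.ofLex_mem z))
  left_inv y := Subtype.ext (by
    change toLex (ofLex (PolySite.pt (ofLex y.1 - (n : ℤ) • v) (mem_shiftSet.1 (PolySite.ofLex_mem y))).1 + (n : ℤ) • v) = y.1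
    rw [PolySite.ofLex_coe_pt, sub_add_cancel, toLex_ofLex])
  right_inv z := Subtype.ext (by
    change toLex (ofLex (PolySite.pt (ofLex z.1 + (n : ℤ) • v) (PolySite.add_mem_shiftSet _ (PolySite.ofLex_mem z))).1 - (n : ℤ) • v) = z.1
    rw [PolySite.ofLex_coe_pt, add_sub_cancel_right, toLex_ofLex])

/-- The underlying site of the back-translated site. [cite: ArakiMoriya2003, §4.1 Def. 4.3] -/
@[simp] theorem ofLex_coe_boxBackEquiv (n : ℕ) (v : Site d) (y : PolySite (shiftSet ((n : ℤ) • v) (halfOpenBox d n))) :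
    ofLex (boxBackEquiv n v y).1 = ofLex y.1 - (n : ℤ) • v := rfl

/-- Back-translation after translation is the identity: `(τ_{nv} ; boxBack) y = y`. [cite: ArakiMoriya2003, §4.1 Def. 4.3] -/
theorem shiftEmb_trans_boxBackEquiv (n : ℕ) (v : Site d) :
    (PolySite.shiftEmb ((n : ℤ) • v) (halfOpenBox d n)).trans (boxBackEquiv n v).toEmbedding = Function.Embedding.refl _ :=
  DFunLike.ext _ _ fun y => Subtype.ext (by
    change toLex (ofLex (PolySite.shiftEmb ((n : ℤ) • v) (halfOpenBox d n) y).1 - (n : ℤ) • v) = y.1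
    rw [PolySite.ofLex_coe_shiftEmb, add_sub_cancel_right, toLex_ofLex])

/-- **The box state transported to the box `B_v`**: the density matrix `tr_{boxBack} ρ₀ ∈ 𝔄(B_v)` of the state
`A ↦ tr(Γ_{boxBack} A · ρ₀)` (`ρ₀` read in the coordinates of `B_v`). [cite: BratteliRobinsonII1997, Thm. 6.2.40] -/
def boxCopy (n : ℕ) (ρ₀ : FermionOp (halfOpenBox d n)) (v : Site d) : FermionOp (shiftSet ((n : ℤ) • v) (halfOpenBox d n)) :=
  fermionPartialTrace (boxBackEquiv n v).toEmbedding ρ₀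

section Copy

variable (n : ℕ) (ρ₀ : FermionOp (halfOpenBox d n)) (v : Site d)

/-- Duality: `tr(A · boxCopy v) = tr(Γ_{boxBack} A · ρ₀)`. [cite: ArakiMoriya2003, §4.1 Def. 4.5] -/
theorem trace_mul_boxCopy (A : FermionOp (shiftSet ((n : ℤ) • v) (halfOpenBox d n))) :
    (A * boxCopy n ρ₀ v).trace = (fermionEmbed (boxBackEquiv n v).toEmbedding A * ρ₀).trace :=
  trace_mul_fermionPartialTrace _ _ _

/-- **Translated observables have the reference expectations**: `tr(Γ_{τ_{nv}} A · boxCopy v) = tr(A ρ₀)`.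
[cite: ArakiMoriya2003, §4.1 Def. 4.3 and Def. 4.5] -/
theorem trace_fermionEmbed_shiftEmb_mul_boxCopy (A : FermionOp (halfOpenBox d n)) :
    (fermionEmbed (PolySite.shiftEmb ((n : ℤ) • v) (halfOpenBox d n)) A * boxCopy n ρ₀ v).trace = (A * ρ₀).trace := by
  rw [trace_mul_boxCopy, fermionEmbed_fermionEmbed, shiftEmb_trans_boxBackEquiv, fermionEmbed_refl_apply]

/-- The transported state has the trace of `ρ₀`. [cite: ArakiMoriya2003, §4.1 Def. 4.5] -/
theorem trace_boxCopy : (boxCopy n ρ₀ v).trace = ρ₀.trace := trace_fermionPartialTrace _ _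

variable {ρ₀}

/-- The transported state is positive semidefinite. [cite: ArakiMoriya2003, §4.1 Def. 4.5] -/
theorem posSemidef_boxCopy (h : ρ₀.PosSemidef) : (boxCopy n ρ₀ v).PosSemidef := posSemidef_fermionPartialTrace _ h

/-- The transported state is faithful if `ρ₀` is. [cite: ArakiMoriya2003, §4.1 Def. 4.5] -/
theorem posDef_boxCopy (h : ρ₀.PosDef) : (boxCopy n ρ₀ v).PosDef := posDef_fermionPartialTrace _ h

/-- The transported state is Hermitian if `ρ₀` is. [cite: ArakiMoriya2003, §4.1 Def. 4.5] -/
theorem isHermitian_boxCopy (h : ρ₀.IsHermitian) : (boxCopy n ρ₀ v).IsHermitian := isHermitian_fermionPartialTrace _ h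

/-- The transported state is even if `ρ₀` is. [cite: ArakiMoriya2003, §11.1 Lemma 11.1] -/
theorem parityAut_boxCopy (h : parityAut ρ₀ = ρ₀) : parityAut (boxCopy n ρ₀ v) = boxCopy n ρ₀ v :=
  parityAut_fermionPartialTrace_of_even _ h

/-- **The transported state has the entropy of `ρ₀`.** [cite: ArakiMoriya2003, §3.1 and §10] -/
theorem vonNeumannEntropy_boxCopy (h : ρ₀.IsHermitian) : vonNeumannEntropy (boxCopy n ρ₀ v) = vonNeumannEntropy ρ₀ :=
  vonNeumannEntropy_fermionPartialTrace_equiv _ h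

end Copy

/-! ### §3. The tiling state `⊗_{v ∈ ℤ^d} ρ₀` -/

namespace InfVolFermionState

section Tiling

variable (n : ℕ) (hn : 1 ≤ n) (ρ₀ : FermionOp (halfOpenBox d n)) (hev : parityAut ρ₀ = ρ₀) (hpsd : ρ₀.PosSemidef)
  (htr : ρ₀.trace = 1)

/-- **THE TILING STATE `⊗_{v ∈ ℤ^d} ρ₀`**: the Araki–Moriya product over the box tiling `B_v = n·v + [0,n)^d` of the
transported copies of one even density matrix `ρ₀` on `[0,n)^d` (Bratteli–Robinson's `⊗_α ρ_{Λ_α}`).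
[cite: BratteliRobinsonII1997, Thm. 6.2.40] [cite: ArakiMoriya2003, §11.1 Theorem 11.2] -/
def boxTilingState : InfVolFermionState d :=
  blockProductState (boxPartition d n hn) (fun v => boxCopy n ρ₀ v) (fun v => parityAut_boxCopy n v hev)
    (fun v => posSemidef_boxCopy n v hpsd) (fun v => (trace_boxCopy n ρ₀ v).trans htr)

/-- Unfolding. [cite: BratteliRobinsonII1997, Thm. 6.2.40] -/
theorem boxTilingState_def : boxTilingState n hn ρ₀ hev hpsd htr =
    blockProductState (boxPartition d n hn) (fun v => boxCopy n ρ₀ v) (fun v => parityAut_boxCopy n v hev)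
      (fun v => posSemidef_boxCopy n v hpsd) (fun v => (trace_boxCopy n ρ₀ v).trans htr) := rfl

/-- **The tiling state on translated reference observables**: `ω_{B_v}(Γ_{τ_{nv}} A) = tr(A ρ₀)` for every `A ∈ 𝔄([0,n)^d)`.
[cite: BratteliRobinsonII1997, Thm. 6.2.40] -/
theorem boxTilingState_expect_shiftEmb (v : Site d) (A : FermionOp (halfOpenBox d n)) :
    (boxTilingState n hn ρ₀ hev hpsd htr).expect (shiftSet ((n : ℤ) • v) (halfOpenBox d n))
      (fermionEmbed (PolySite.shiftEmb ((n : ℤ) • v) (halfOpenBox d n)) A) = (A * ρ₀).trace := by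
  have h := blockProductState_expect_block (boxPartition d n hn) (fun v => boxCopy n ρ₀ v) (fun v => parityAut_boxCopy n v hev)
    (fun v => posSemidef_boxCopy n v hpsd) (fun v => (trace_boxCopy n ρ₀ v).trans htr) v
    (fermionEmbed (PolySite.shiftEmb ((n : ℤ) • v) (halfOpenBox d n)) A)
  rw [trace_fermionEmbed_shiftEmb_mul_boxCopy] at h
  exact h

/-- On the reference box itself: `ω_{[0,n)^d}(A) = tr(A ρ₀)`. [cite: BratteliRobinsonII1997, Thm. 6.2.40] -/
theorem boxTilingState_expect_box_zero (A : FermionOp (halfOpenBox d n)) :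
    (boxTilingState n hn ρ₀ hev hpsd htr).expect (halfOpenBox d n) A = (A * ρ₀).trace := by
  have hsub : halfOpenBox d n ⊆ shiftSet ((n : ℤ) • (0 : Site d)) (halfOpenBox d n) := fun y hy => by
    rw [mem_shiftSet, smul_zero, sub_zero]; exact hy
  rw [← (boxTilingState n hn ρ₀ hev hpsd htr).compatible hsub A]
  have h : fermionEmbed (PolySite.incl hsub) A = fermionEmbed (PolySite.shiftEmb ((n : ℤ) • (0 : Site d)) (halfOpenBox d n)) A :=
    congrFun (congrArg DFunLike.coe (fermionEmbed_congr fun y => Subtype.ext (by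
      change y.1 = toLex (ofLex y.1 + (n : ℤ) • (0 : Site d))
      rw [smul_zero, add_zero, toLex_ofLex]))) A
  rw [h, boxTilingState_expect_shiftEmb]

/-- **The tiling state on the box Hamiltonians of a translation-covariant interaction**: `ω(H_{B_v}) = tr(H_{[0,n)^d} ρ₀)`.
[cite: BratteliRobinsonII1997, Thm. 6.2.40] -/
theorem boxTilingState_expect_localHamiltonian {Ψ : FermionInteraction d} (hT : Ψ.IsTranslationInvariant) (v : Site d) :
    (boxTilingState n hn ρ₀ hev hpsd htr).expect (shiftSet ((n : ℤ) • v) (halfOpenBox d n))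
      (Ψ.localHamiltonian (shiftSet ((n : ℤ) • v) (halfOpenBox d n))) = (Ψ.localHamiltonian (halfOpenBox d n) * ρ₀).trace := by
  rw [← hT.fermionEmbed_shiftEmb_localHamiltonian, boxTilingState_expect_shiftEmb]

/-- **The marginal of the tiling state on the box `B_v` is the transported copy of `ρ₀`.**
[cite: ArakiMoriya2003, §11.1 Theorem 11.2] -/
theorem rdm_boxTilingState_box (v : Site d) :
    (boxTilingState n hn ρ₀ hev hpsd htr).rdm (shiftSet ((n : ℤ) • v) (halfOpenBox d n)) = boxCopy n ρ₀ v :=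
  rdm_blockProductState_block (boxPartition d n hn) (fun v => boxCopy n ρ₀ v) (fun v => parityAut_boxCopy n v hev)
    (fun v => posSemidef_boxCopy n v hpsd) (fun v => (trace_boxCopy n ρ₀ v).trans htr) v

/-- Hence the box marginals have the entropy of `ρ₀`. [cite: ArakiMoriya2003, Theorem 3.8 and §10] -/
theorem vonNeumannEntropy_rdm_boxTilingState_box (v : Site d) :
    vonNeumannEntropy ((boxTilingState n hn ρ₀ hev hpsd htr).rdm (shiftSet ((n : ℤ) • v) (halfOpenBox d n))) = vonNeumannEntropy ρ₀ := by
  rw [rdm_boxTilingState_box, vonNeumannEntropy_boxCopy n v hpsd.1]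

/-- The tiling state is even. [cite: ArakiMoriya2003, §11.1 Theorem 11.2 Remark 2] -/
theorem boxTilingState_isEven : (boxTilingState n hn ρ₀ hev hpsd htr).IsEven :=
  blockProductState_isEven _ _ _ _ _

/-! ### §4. Periodicity and the translation-invariant cell average -/

/-- The translation by `n·w` restricted to a part: `Λ ∩ B_{j−w} → (Λ + n·w) ∩ B_j`, `x ↦ x + n·w`.
[cite: ArakiMoriya2003, §4.1 Def. 4.3] -/
def boxPartShiftEmb (w : Site d) (Λ : Finset (Site d)) (j : Site d) :
    PolySite ((boxPartition d n hn).blockLoc Λ (j - w)) ↪ PolySite ((boxPartition d n hn).blockLoc (shiftSet ((n : ℤ) • w) Λ) j) :=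
  ⟨fun y => PolySite.pt (ofLex y.1 + (n : ℤ) • w) (by
      have hy := (boxPartition d n hn).mem_blockLoc.1 (PolySite.ofLex_mem y)
      refine (boxPartition d n hn).mem_blockLoc.2 ⟨PolySite.add_mem_shiftSet _ hy.1, ?_⟩
      rw [boxPartition_cls_add_smul, hy.2, sub_add_cancel]),
    fun y y' h => Subtype.ext (by
      have h1 := congrArg (fun z : PolySite ((boxPartition d n hn).blockLoc (shiftSet ((n : ℤ) • w) Λ) j) => ofLex z.1) h
      simp only [PolySite.ofLex_coe_pt, add_left_inj] at h1
      exact congrArg toLex h1)⟩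

/-- Underlying site of the shifted part site. [cite: ArakiMoriya2003, §4.1 Def. 4.3] -/
@[simp] theorem ofLex_coe_boxPartShiftEmb (w : Site d) (Λ : Finset (Site d)) (j : Site d)
    (y : PolySite ((boxPartition d n hn).blockLoc Λ (j - w))) :
    ofLex (boxPartShiftEmb n hn w Λ j y).1 = ofLex y.1 + (n : ℤ) • w := rfl

/-- **Translating a part-embedded observable by `n·w`** lands in the part of class `j = i + w` of the translated region:
`Γ(τ_{nw})(Γ_{Λ,i} a) = Γ_{Λ+nw, j}(Γ_{shift} a)` for `i = j − w`. [cite: ArakiMoriya2003, §4.1 Def. 4.3] -/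
theorem fermionEmbed_shiftEmb_blockEmb (w : Site d) (Λ : Finset (Site d)) (j : Site d)
    (a : FermionOp ((boxPartition d n hn).blockLoc Λ (j - w))) :
    fermionEmbed (PolySite.shiftEmb ((n : ℤ) • w) Λ) (fermionEmbed ((boxPartition d n hn).blockEmb Λ (j - w)) a) =
      fermionEmbed ((boxPartition d n hn).blockEmb (shiftSet ((n : ℤ) • w) Λ) j) (fermionEmbed (boxPartShiftEmb n hn w Λ j) a) := by
  rw [fermionEmbed_fermionEmbed, fermionEmbed_fermionEmbed]
  exact congrFun (congrArg DFunLike.coe (fermionEmbed_congr fun y => Subtype.ext rfl)) a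

/-- **Block values are translation covariant**: the value of block `j` on the translated observable equals the value of
block `j − w` on the original one (both are `tr(Γ_{x ↦ x − n(j−w)} a · ρ₀)`). [cite: ArakiMoriya2003, §4.1 Def. 4.3 and Def. 4.5] -/
theorem blockVal_boxCopy_shift (w : Site d) (Λ : Finset (Site d)) (j : Site d)
    (a : FermionOp ((boxPartition d n hn).blockLoc Λ (j - w))) :
    blockVal (boxPartition d n hn) (fun v => boxCopy n ρ₀ v) j
        ((boxPartition d n hn).blockLoc_subset_block (shiftSet ((n : ℤ) • w) Λ) j) (fermionEmbed (boxPartShiftEmb n hn w Λ j) a) =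
      blockVal (boxPartition d n hn) (fun v => boxCopy n ρ₀ v) (j - w) ((boxPartition d n hn).blockLoc_subset_block Λ (j - w)) a := by
  rw [blockVal_apply, blockVal_apply]
  change (_ * boxCopy n ρ₀ j).trace = (_ * boxCopy n ρ₀ (j - w)).trace
  rw [boxCopy, boxCopy, trace_mul_fermionPartialTrace, trace_mul_fermionPartialTrace, fermionEmbed_fermionEmbed,
    fermionEmbed_fermionEmbed, fermionEmbed_fermionEmbed]
  congr 2
  exact congrFun (congrArg DFunLike.coe (fermionEmbed_congr fun y => Subtype.ext (by
    change toLex (ofLex y.1 + (n : ℤ) • w - (n : ℤ) • j) = toLex (ofLex y.1 - (n : ℤ) • (j - w))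
    rw [smul_sub]
    congr 1
    abel))) a

/-- **PERIODICITY OF THE TILING STATE**: `(⊗_v ρ₀) ∘ τ_{n·w} = ⊗_v ρ₀` for every `w ∈ ℤ^d` (uniqueness of the block product
state: the translated state has the same block marginals and the product property). [cite: BratteliRobinsonII1997, Thm. 6.2.40]
[cite: ArakiMoriya2003, §11.1 Theorem 11.2 (uniqueness)] -/
theorem boxTilingState_shift_smul (w : Site d) :
    (boxTilingState n hn ρ₀ hev hpsd htr).shift ((n : ℤ) • w) = boxTilingState n hn ρ₀ hev hpsd htr := by
  refine eq_blockProductState_of_forall_prod (boxPartition d n hn) (fun v => boxCopy n ρ₀ v) (fun v => parityAut_boxCopy n v hev)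
    (fun v => posSemidef_boxCopy n v hpsd) (fun v => (trace_boxCopy n ρ₀ v).trans htr) fun Λ l hl hΛl a => ?_
  rw [shift_expect, map_list_prod, List.map_map]
  -- the translated observables, indexed by the translated classes `j = i + w`
  set a' : (j : Site d) → FermionOp ((boxPartition d n hn).blockLoc (shiftSet ((n : ℤ) • w) Λ) j) :=
    fun j => fermionEmbed (boxPartShiftEmb n hn w Λ j) (a (j - w)) with ha'
  have hterm : ∀ i, fermionEmbed (PolySite.shiftEmb ((n : ℤ) • w) Λ) (fermionEmbed ((boxPartition d n hn).blockEmb Λ i) (a i)) =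
      fermionEmbed ((boxPartition d n hn).blockEmb (shiftSet ((n : ℤ) • w) Λ) (i + w)) (a' (i + w)) := by
    intro i
    have key : ∀ j i, i = j - w →
        fermionEmbed (PolySite.shiftEmb ((n : ℤ) • w) Λ) (fermionEmbed ((boxPartition d n hn).blockEmb Λ i) (a i)) =
          fermionEmbed ((boxPartition d n hn).blockEmb (shiftSet ((n : ℤ) • w) Λ) j) (a' j) := by
      rintro j i rfl
      exact fermionEmbed_shiftEmb_blockEmb n hn w Λ j (a (j - w))
    exact key (i + w) i (by rw [add_sub_cancel_right])
  have hlist : (l.map (⇑(fermionEmbed (PolySite.shiftEmb ((n : ℤ) • w) Λ)) ∘ fun i => fermionEmbed ((boxPartition d n hn).blockEmb Λ i) (a i))) =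
      (l.map (· + w)).map fun j => fermionEmbed ((boxPartition d n hn).blockEmb (shiftSet ((n : ℤ) • w) Λ) j) (a' j) := by
    rw [List.map_map]
    exact List.map_congr_left fun i _ => hterm i
  rw [hlist]
  -- product property on the translated region
  have hl' : (l.map (· + w)).Nodup := hl.map (add_left_injective w)
  have hΛl' : ∀ j ∈ (boxPartition d n hn).blockClasses (shiftSet ((n : ℤ) • w) Λ), j ∈ l.map (· + w) := by
    intro j hj
    obtain ⟨y, hy, hyj⟩ := Finset.mem_image.1 hj
    have hy' : y - (n : ℤ) • w ∈ Λ := mem_shiftSet.1 hy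
    have hcls : (boxPartition d n hn).cls (y - (n : ℤ) • w) = j - w := by
      have h := boxPartition_cls_add_smul n hn (y - (n : ℤ) • w) w
      rw [sub_add_cancel] at h
      rw [eq_sub_iff_add_eq, ← h, hyj]
    refine List.mem_map.2 ⟨j - w, hΛl _ ?_, sub_add_cancel j w⟩
    rw [← hcls]
    exact (boxPartition d n hn).cls_mem_blockClasses hy'
  rw [boxTilingState_def, blockProductState_expect_prod (boxPartition d n hn) _ _ _ _ _ _ hl' hΛl' a', List.map_map]
  refine congrArg List.prod (List.map_congr_left fun i _ => ?_)
  -- block values are covariant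
  have key : ∀ j i, i = j - w →
      blockVal (boxPartition d n hn) (fun v => boxCopy n ρ₀ v) j ((boxPartition d n hn).blockLoc_subset_block (shiftSet ((n : ℤ) • w) Λ) j) (a' j) =
        blockVal (boxPartition d n hn) (fun v => boxCopy n ρ₀ v) i ((boxPartition d n hn).blockLoc_subset_block Λ i) (a i) := by
    rintro j i rfl
    exact blockVal_boxCopy_shift n hn ρ₀ w Λ j (a (j - w))
  exact key (i + w) i (by rw [add_sub_cancel_right])

include hn in
/-- The superlattice period vectors are `n·e_i`. [cite: ArakiMoriya2003, §4.1] -/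
theorem periodVec_const_sub_one (i : Fin d) : periodVec (fun _ : Fin d => n - 1) i = (n : ℤ) • (Pi.single i 1 : Site d) := by
  funext j
  rw [periodVec, Pi.smul_apply, smul_eq_mul]
  by_cases hj : j = i
  · subst hj
    rw [Pi.single_eq_same, Pi.single_eq_same, mul_one, Nat.cast_sub hn, Nat.cast_one, sub_add_cancel]
  · rw [Pi.single_eq_of_ne hj, Pi.single_eq_of_ne hj, mul_zero]

/-- **The tiling state is `nℤ^d`-periodic.** [cite: BratteliRobinsonII1997, Thm. 6.2.40] -/
theorem boxTilingState_isPeriodic : (boxTilingState n hn ρ₀ hev hpsd htr).IsPeriodic (fun _ : Fin d => n - 1) := fun i => by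
  rw [periodVec_const_sub_one n hn]
  exact boxTilingState_shift_smul n hn ρ₀ hev hpsd htr _

/-- **THE TRIAL STATE**: the cell average `n^{-d} Σ_{r ∈ [0,n)^d} (⊗_v ρ₀) ∘ τ_r` of the tiling state — a
TRANSLATION-INVARIANT state of the CAR algebra over `ℤ^d` (Bratteli–Robinson's `ω̄_Λ`).
[cite: BratteliRobinsonII1997, Thm. 6.2.40] [cite: BratteliRobinsonI1987, §4.3.1] -/
def boxTrialState : InfVolFermionState d :=
  (boxTilingState n hn ρ₀ hev hpsd htr).cellAverage (fun _ : Fin d => n - 1)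

/-- Unfolding. [cite: BratteliRobinsonII1997, Thm. 6.2.40] -/
theorem boxTrialState_def : boxTrialState n hn ρ₀ hev hpsd htr =
    (boxTilingState n hn ρ₀ hev hpsd htr).cellAverage (fun _ : Fin d => n - 1) := rfl

/-- **THE TRIAL STATE IS TRANSLATION INVARIANT.** [cite: BratteliRobinsonII1997, Thm. 6.2.40] [cite: BratteliRobinsonI1987, §4.3.1] -/
theorem boxTrialState_isTranslationInvariant : (boxTrialState n hn ρ₀ hev hpsd htr).IsTranslationInvariant :=
  (boxTilingState_isPeriodic n hn ρ₀ hev hpsd htr).isTranslationInvariant_cellAverage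

/-- The local expectations of the trial state are the cell averages of translated expectations of the tiling state:
`ω̄_Λ(A) = |C|⁻¹ Σ_{c} ω_{Λ + pos c}(Γ(τ_{pos c}) A)`. [cite: BratteliRobinsonI1987, §4.3.1] -/
theorem boxTrialState_expect (Λ : Finset (Site d)) (A : FermionOp Λ) :
    (boxTrialState n hn ρ₀ hev hpsd htr).expect Λ A =
      (((Fintype.card (Cell (fun _ : Fin d => n - 1)) : ℝ)⁻¹ : ℝ) : ℂ) *
        ∑ c : Cell (fun _ : Fin d => n - 1), (boxTilingState n hn ρ₀ hev hpsd htr).expect (shiftSet (cellPos c) Λ)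
          (fermionEmbed (PolySite.shiftEmb (cellPos c) Λ) A) := by
  rw [boxTrialState_def, InfVolFermionState.cellAverage, shiftAverage_expect]
  rfl

include hn in
/-- The cell has `n^d` points. [cite: ArakiMoriya2003, §4.1] -/
theorem card_cell_const_sub_one : Fintype.card (Cell (fun _ : Fin d => n - 1)) = n ^ d := by
  rw [Fintype.card_pi, Finset.prod_const, Finset.card_univ, Fintype.card_fin, Fintype.card_fin, Nat.sub_add_cancel hn]

include hn in
/-- Cell positions lie in the reference box: `0 ≤ (pos c)_i ≤ n − 1`. [cite: ArakiMoriya2003, §4.1] -/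
theorem cellPos_mem_halfOpenBox (c : Cell (fun _ : Fin d => n - 1)) : cellPos c ∈ halfOpenBox d n := by
  rw [mem_halfOpenBox]
  intro i
  have h : ((c i : ℕ)) < n - 1 + 1 := (c i).isLt
  refine ⟨by simp [cellPos], ?_⟩
  simp only [cellPos]
  omega

end Tiling

end InfVolFermionState

end Literature.MathematicalPhysics.QuantumLattice

end
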